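import Summits.Ventures.HodgeRepro2.T5CyclotomicInfinitelyManyPlaces

/-!
# A chosen prime of `𝓞_K` above a place of `K⁺`

Tier-5 support N3 / §G-N4.2 (seat p3, gen 88). The record indexes places of `K⁺` by rational primes
(`placeAboveCyc K p`, a chosen prime of `𝓞_{K⁺}` above `(p)`); the joint statements of files 358 / 359 / 363 / 365
need, at a given place `v` of `K⁺`, a prime `P` of `K` above `v` (to read the census: `f(P/p)`, «stays prime»). This
file chooses one, with Mathlib's `Ideal.nonempty_primesOver` (the ring of integers of `K` is integral over that of
`K⁺`):

* `primeOverPlace K v : v.asIdeal.primesOver (𝓞 K)` — a chosen prime of `𝓞_K` above `v`;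
* `primeOverPlace_isPrime`, `primeOverPlace_liesOver` — it is prime and lies above `v`;
* `primeOverPlace_liesOver_int` — it lies above `(p)` when `v` does (`Ideal.LiesOver.trans`).

Used by file 364 (the places of `F = ℚ(ζ₂₁)^{⟨σ₁₃⟩}` above `p ≡ 2 (mod 21)`) and by the `ℚ(ζ₉)` companions.
§8(d): uses an L-value-free non-vanishing device: NO.
-/

open NumberField IsDedekindDomain IsDedekindDomain.HeightOneSpectrum

namespace Summit.Ventures.HodgeRepro2.T5PrimeOverPlace

variable (K : Type*) [Field K]

/-- A chosen prime of `𝓞_K` above a place `v` of `K⁺` (Mathlib's `Ideal.nonempty_primesOver`). -/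
noncomputable def primeOverPlace (v : HeightOneSpectrum (𝓞 (maximalRealSubfield K))) :
    v.asIdeal.primesOver (𝓞 K) :=
  (Ideal.nonempty_primesOver (S := 𝓞 K) v.asIdeal).some

/-- The chosen prime is prime. -/
theorem primeOverPlace_isPrime (v : HeightOneSpectrum (𝓞 (maximalRealSubfield K))) :
    (primeOverPlace K v).1.IsPrime :=
  (primeOverPlace K v).2.1

/-- The chosen prime lies above `v`. -/
theorem primeOverPlace_liesOver (v : HeightOneSpectrum (𝓞 (maximalRealSubfield K))) :
    (primeOverPlace K v).1.LiesOver v.asIdeal :=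
  (primeOverPlace K v).2.2

/-- The chosen prime lies above `(p)` when `v` does (`Ideal.LiesOver.trans`). -/
theorem primeOverPlace_liesOver_int (p : ℕ) (v : HeightOneSpectrum (𝓞 (maximalRealSubfield K)))
    [v.asIdeal.LiesOver (Ideal.span {(p : ℤ)})] :
    (primeOverPlace K v).1.LiesOver (Ideal.span {(p : ℤ)}) :=
  haveI := primeOverPlace_liesOver K v
  Ideal.LiesOver.trans (primeOverPlace K v).1 v.asIdeal (Ideal.span {(p : ℤ)})

end Summit.Ventures.HodgeRepro2.T5PrimeOverPlace
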